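import Summits.QuantumFields.BalabanUV.Beta.GAN24.SymPush3BorderGaugeSlotCellsRight
import Summits.QuantumFields.BalabanUV.Beta.GAN24.ContactBorderKernelCells
import Summits.QuantumFields.BalabanUV.Beta.GAN24.Push3LegTelescope

/-!
# `GAN24.SymContactBorderKernelCells` — THE TWO CHANNEL CONTACT DIFFERENCES OF THE SYMMETRISED BORDER TABLE ARE EXPLICIT ONE-GAUGE CELLS (`T − B = dz λ` in the two
# field slots; the multiplier leg common) — the sym twin of leaf-02 g48's (E) `GAN24.ContactBorderKernelCells` over `SymPush3BorderGaugeSlotCellsRight`; these are the cells of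
# the RIGHT side of the OWNER's `CombBornBorderContactNest.combContact_v_eq_of_succ ∕ _of_top` at the record's `tabs.V = symVhSAt ρ_c`
NOT IN PRINT — OUR BOOKKEEPING (OWNER `b2b-balaban-gan24-p1` gen 55, 2026-08-28; row G-an2-4 ∕ (CONV-C), TRANSFER-III, the (III′) S-slot (b), born-V contact letter `hCv` of
road-P2 M.104 — TABLE HALF at an1's (0.4)-SYMMETRISED border table `symVhSAt ρ` (the type of `SymTables.V` at the literal of record), per the OWNER's design memo
`HCV-DESIGN-g55.md` §1: a mkroot-style token re-run of the (E) file named below with `symVhSAt ρ ↦ symVhSAt ρ`, `linSym04At ρ L ↦ linSym04At ρ L` (entries `lin04KerAt = symLinKerAt`,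
an1's `lin04KerAt_eq_symLinKerAt`), the rooted Ward laws ↦ leaf-02 g47's `SymBorderGaugeLegContact` ∕ an1-g42's `SymAveragingWardRootedStencils.divV_symVhSAt_apply`, the kernel
support ∕ size ↦ an1's `symVhKerAt_eq_zero_left ∕ _right`, `symLinKerAt_eq_zero`, `abs_symLinKerAt_le` (SAME window `Near`, SAME bound `ℓ`); every TABLE-FREE lemma of the (E)
file is consumed BY NAME, not copied.  [folklore] bookkeeping; 0 `def`, 0 cited fact, 0 `def … : Prop`, 0 sorry; NO estimate of Bałaban's beyond an1's DEFINED kernels.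
HONEST FRAMING (cell contract, verbatim): «discharging `BetaPertH` makes Bałaban's UV stability UNCONDITIONAL — a real constructive-QFT result; it is NOT the continuum limit
and NOT the Clay problem.»  HONEST DEPENDENCY (verbatim): «continuum YM on T⁴ ⇐ BetaPertH ∧ nine spine estimates (0/9 proved); BetaPertH ⇐ (D1) ∧ (D4) ∧ CAP+tail; G-an2-4
gates asym, D1 and NE2/3/4.»  Discharges NO letter of M.104 ∕ of the OWNER's END `CombChargeRowsOfBornContactLetters` (hCv stays a HYPOTHESIS); NEVER «G-an2-4 closed» as (CONV-C);
NOT D1, NOT BetaPertH, NOT continuum, NOT Clay.  2026-08-28; no existing file touched.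

## What (generic `d`; same statements as the (E) file with `symVhSAt ↦ symVhSAt`, `linSym04At ↦ linSym04At`)
`locStencil_reslot_symVhSAt`, `contact_border_fm_eq_cells`, `contact_border_mf_eq_cells`.
-/

open Finset
open scoped BigOperators Nat
open Literature.MathematicalPhysics.QuantumFieldTheory.Balaban1983to89
open Literature.MathematicalPhysics.QuantumFieldTheory.Balaban1983to89.Beta
open AffineAveraging AveragingContours AveragingHessianKernels AveragingContoursRooted AveragingHessianKernelsRooted
open ExpKernelCalculus (MKer)
open OneStepResolventKernel (Fib LocStencil)
open Summit.QuantumFields.BalabanUV.Beta.SymAveragingHessianCounts (symVhSAt symVhSAt_symm symVhKerAt_eq_zero_left symVhKerAt_eq_zero_right symLinKerAt_eq_zero abs_symLinKerAt_le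
  locStencil_symVhSAt)
open Summit.QuantumFields.BalabanUV.Beta.SymAveragingWardRootedStencils (lin04KerAt_eq_symLinKerAt)
open Summit.QuantumFields.BalabanUV.Beta.DshAn1 (linSym04At linSym04At_inl_inr linSym04At_inr_inl linSym04At_inl_inl linSym04At_inr_inr linSym04At_symm)
open Summit.QuantumFields.BalabanUV.Beta.GAN24.Push3 (push₃)
open Summit.QuantumFields.BalabanUV.Beta.GAN24.SrecLinearPartEq (reslot locStencil_reslot)
open Summit.QuantumFields.BalabanUV.Beta.GAN24.Push3LegTelescope (push₃_sub_left push₃_sub_right push₃_sub_table)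
open Summit.QuantumFields.BalabanUV.Beta.GAN24.SymPush3BorderGaugeSlotCells (push₃_gaugeLeft_border push₃_gaugeTable_border)
open Summit.QuantumFields.BalabanUV.Beta.GAN24.SymPush3BorderGaugeSlotCellsRight (push₃_gaugeTable_border' push₃_gaugeRight_border)

noncomputable section

namespace Summit.QuantumFields.BalabanUV.Beta.GAN24.SymContactBorderKernelCells

variable {d : ℕ}

/-! ## §1 The re-slotted border channels are local stencil families -/

/-- [folklore] Every re-slotted channel of the rooted border table (box root) is a `LocStencil` family at rate `1`. -/
theorem locStencil_reslot_symVhSAt {L : ℕ} (hL : 1 ≤ L) {rr : Fin (d + 1) → ℕ} (hrr : rr ∈ box (d + 1) L) (σ τ : Fin (d + 1) → Fib d) :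
    LocStencil (reslot σ τ (symVhSAt (toSite rr) d L rfl)) (3 * (ell (d + 1) L : ℝ) ^ 2 * Real.exp (4 * ((d : ℝ) + 1) * L * 1)) 1 :=
  locStencil_reslot (locStencil_symVhSAt hL hrr zero_le_one) σ τ

/-! ## §2 The field–multiplier channel `reslot inl inr V` -/

section FM

variable {lE lB M wE wB : Fin (d + 1) → (Fin (d + 1) → ℤ) → Fin (d + 1) → (Fin (d + 1) → ℤ) → ℝ}
variable {lamL lamW : Fin (d + 1) → (Fin (d + 1) → ℤ) → (Fin (d + 1) → ℤ) → ℝ} {ClE ClB CwE CwB : ℝ}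

/-- [folklore] **THE CONTACT TERM OF THE FIELD–MULTIPLIER CHANNEL IS TWO ONE-GAUGE BORDER CELLS** (summable class; the multiplier leg `M` common to both readings):
`push₃ lᴱ M wᴱ S − push₃ lᴮ M wᴮ S = [LEFT cell, partners M, wᴱ, gauge λ_L] + [TABLE cell, partners lᴮ, M, gauge λ_W]`, `S = reslot inl inr V`. -/
theorem contact_border_fm_eq_cells {L : ℕ} (hL : 1 ≤ L) {rr : Fin (d + 1) → ℕ} (hrr : rr ∈ box (d + 1) L)
    (hlE : ∀ α x' κ x, |lE α x' κ x| ≤ ClE) (hlEs : ∀ α x' κ, Summable fun x => lE α x' κ x)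
    (hlB : ∀ α x' κ x, |lB α x' κ x| ≤ ClB) (hlBs : ∀ α x' κ, Summable fun x => lB α x' κ x)
    (hMs : ∀ β z' κ, Summable fun z => M β z' κ z)
    (hwE : ∀ κ' u' κ u, |wE κ' u' κ u| ≤ CwE) (hwB : ∀ κ' u' κ u, |wB κ' u' κ u| ≤ CwB)
    (hLg : lE - lB = fun μ y κ u => dz (lamL μ y) κ u) (hWg : wE - wB = fun μ y κ u => dz (lamW μ y) κ u)
    (κ' : Fin (d + 1)) (u' x' z' : Fin (d + 1) → ℤ) (α β : Fin (d + 1)) :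
    push₃ lE M wE (reslot Sum.inl Sum.inr (symVhSAt (toSite rr) d L rfl)) κ' u' x' z' (Sum.inl α) (Sum.inl β)
        - push₃ lB M wB (reslot Sum.inl Sum.inr (symVhSAt (toSite rr) d L rfl)) κ' u' x' z' (Sum.inl α) (Sum.inl β)
      = (∑' z, ∑ μ, M β z' μ z * ∑' u, ∑ κ, wE κ' u' κ u *
            ((lamL α x' (u + unitVec κ) - lamL α x' (z + toSite rr + (L : ℤ) • unitVec μ)) * linSym04At (toSite rr) L u z (Sum.inl κ) (Sum.inr μ)))
        + (∑' z, ∑ μ, M β z' μ z * ∑' x, ∑ a, lB α x' a x *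
            ((lamW κ' u' (z + toSite rr) - lamW κ' u' x) * linSym04At (toSite rr) L x z (Sum.inl a) (Sum.inr μ))) := by
  have hS := locStencil_reslot_symVhSAt hL hrr Sum.inl Sum.inr
  have h1 := push₃_sub_left hlE hlEs hlB hlBs hMs hwE hS one_pos κ' u'
  have h2 := push₃_sub_table hlB hlBs hMs hwE hwB hS one_pos κ' u'
  have e1 := congrFun (congrFun (congrFun (congrFun h1 x') z') (Sum.inl α)) (Sum.inl β)
  have e2 := congrFun (congrFun (congrFun (congrFun h2 x') z') (Sum.inl α)) (Sum.inl β)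
  simp only [Pi.sub_apply] at e1 e2
  have e : push₃ lE M wE (reslot Sum.inl Sum.inr (symVhSAt (toSite rr) d L rfl)) κ' u' x' z' (Sum.inl α) (Sum.inl β)
        - push₃ lB M wB (reslot Sum.inl Sum.inr (symVhSAt (toSite rr) d L rfl)) κ' u' x' z' (Sum.inl α) (Sum.inl β)
      = push₃ (lE - lB) M wE (reslot Sum.inl Sum.inr (symVhSAt (toSite rr) d L rfl)) κ' u' x' z' (Sum.inl α) (Sum.inl β)
        + push₃ lB M (wE - wB) (reslot Sum.inl Sum.inr (symVhSAt (toSite rr) d L rfl)) κ' u' x' z' (Sum.inl α) (Sum.inl β) := by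
    rw [e1, e2]; ring
  rw [e, hLg, hWg, push₃_gaugeLeft_border M wE lamL hL hrr, push₃_gaugeTable_border lB M lamW hL hrr]

end FM

/-! ## §3 The multiplier–field channel `reslot inr inl V` -/

section MF

variable {M rE rB wE wB : Fin (d + 1) → (Fin (d + 1) → ℤ) → Fin (d + 1) → (Fin (d + 1) → ℤ) → ℝ}
variable {lamR lamW : Fin (d + 1) → (Fin (d + 1) → ℤ) → (Fin (d + 1) → ℤ) → ℝ} {CM CrE CrB CwE CwB : ℝ}

/-- [folklore] **THE CONTACT TERM OF THE MULTIPLIER–FIELD CHANNEL IS TWO ONE-GAUGE BORDER CELLS** (summable class; the multiplier rows `M` common, bounded with summable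
fine rows; the dressed right legs bounded with summable slices): `push₃ M rᴱ wᴱ S − push₃ M rᴮ wᴮ S = [RIGHT cell, partners M, wᴱ, gauge λ_R] + [TABLE cell,
partners rᴮ, M, gauge λ_W]`, `S = reslot inr inl V`. -/
theorem contact_border_mf_eq_cells {L : ℕ} (hL : 1 ≤ L) {rr : Fin (d + 1) → ℕ} (hrr : rr ∈ box (d + 1) L)
    (hM : ∀ α x' κ x, |M α x' κ x| ≤ CM) (hMs : ∀ α x' κ, Summable fun x => M α x' κ x)
    (hrE : ∀ β z' κ z, |rE β z' κ z| ≤ CrE) (hrEs : ∀ β z' κ, Summable fun z => rE β z' κ z)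
    (hrB : ∀ β z' κ z, |rB β z' κ z| ≤ CrB) (hrBs : ∀ β z' κ, Summable fun z => rB β z' κ z)
    (hwE : ∀ κ' u' κ u, |wE κ' u' κ u| ≤ CwE) (hwB : ∀ κ' u' κ u, |wB κ' u' κ u| ≤ CwB)
    (hRg : rE - rB = fun μ y κ u => dz (lamR μ y) κ u) (hWg : wE - wB = fun μ y κ u => dz (lamW μ y) κ u)
    (κ' : Fin (d + 1)) (u' x' z' : Fin (d + 1) → ℤ) (α β : Fin (d + 1)) :
    push₃ M rE wE (reslot Sum.inr Sum.inl (symVhSAt (toSite rr) d L rfl)) κ' u' x' z' (Sum.inl α) (Sum.inl β)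
        - push₃ M rB wB (reslot Sum.inr Sum.inl (symVhSAt (toSite rr) d L rfl)) κ' u' x' z' (Sum.inl α) (Sum.inl β)
      = (∑' x, ∑ a, M α x' a x * ∑' u, ∑ κ, wE κ' u' κ u *
            ((lamR β z' (u + unitVec κ) - lamR β z' (x + toSite rr + (L : ℤ) • unitVec a)) * linSym04At (toSite rr) L u x (Sum.inl κ) (Sum.inr a)))
        + (∑' z, ∑ b, rB β z' b z * ∑' x, ∑ a, M α x' a x *
            ((lamW κ' u' (x + toSite rr) - lamW κ' u' z) * linSym04At (toSite rr) L z x (Sum.inl b) (Sum.inr a))) := by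
  have hS := locStencil_reslot_symVhSAt hL hrr Sum.inr Sum.inl
  -- the gauge increments of the right slot are bounded (difference of two bounded families)
  have hgR : ∀ μ y κ u, |dz (lamR μ y) κ u| ≤ CrE + CrB := by
    intro μ y κ u
    have e : dz (lamR μ y) κ u = (rE - rB) μ y κ u := by rw [hRg]
    rw [e, Pi.sub_apply, Pi.sub_apply, Pi.sub_apply, Pi.sub_apply]
    exact (abs_sub _ _).trans (add_le_add (hrE μ y κ u) (hrB μ y κ u))
  have h1 := push₃_sub_right hM hrEs hrBs hwE hS one_pos κ' u'
  have h2 := push₃_sub_table hM hMs hrBs hwE hwB hS one_pos κ' u'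
  have e1 := congrFun (congrFun (congrFun (congrFun h1 x') z') (Sum.inl α)) (Sum.inl β)
  have e2 := congrFun (congrFun (congrFun (congrFun h2 x') z') (Sum.inl α)) (Sum.inl β)
  simp only [Pi.sub_apply] at e1 e2
  have e : push₃ M rE wE (reslot Sum.inr Sum.inl (symVhSAt (toSite rr) d L rfl)) κ' u' x' z' (Sum.inl α) (Sum.inl β)
        - push₃ M rB wB (reslot Sum.inr Sum.inl (symVhSAt (toSite rr) d L rfl)) κ' u' x' z' (Sum.inl α) (Sum.inl β)
      = push₃ M (rE - rB) wE (reslot Sum.inr Sum.inl (symVhSAt (toSite rr) d L rfl)) κ' u' x' z' (Sum.inl α) (Sum.inl β)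
        + push₃ M rB (wE - wB) (reslot Sum.inr Sum.inl (symVhSAt (toSite rr) d L rfl)) κ' u' x' z' (Sum.inl α) (Sum.inl β) := by
    rw [e1, e2]; ring
  rw [e, hRg, hWg, push₃_gaugeRight_border hL hrr hMs hgR hwE, push₃_gaugeTable_border' M rB lamW hL hrr]

end MF

end Summit.QuantumFields.BalabanUV.Beta.GAN24.SymContactBorderKernelCells

end
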